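import Mathlib.Analysis.MeanInequalities
import Mathlib.Analysis.MeanInequalitiesPow
import Mathlib.Analysis.SpecialFunctions.Pow.Real
import Mathlib.Analysis.SpecialFunctions.Log.Basic
import Literature.Computability.Complexity.FourierTails
import HarnessLib

/-!
# The Bonami lemma (even moments) and the level-`k` inequalities on the cube `{0,1}^m`

Infrastructure (O'Donnell, *Analysis of Boolean Functions*, 2014, Ch. 9) for hypercontractive
arguments about Boolean functions in `Literature/Computability`; first consumer: the Fourier growth
of XOR-fibres of rectangle partitions (the classical side of the algebraic oracle separation
`BQP^A ⊄ BPP^Ã`, file `Literature/Computability/Complexity/AlgebrizationBarriers`). Conventions are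
those of `BooleanFourier.lean` / `FourierTails.lean`: real functions `g : (Fin m → Bool) → ℝ`,
coefficients `cubeFourierCoeff g S = ĝ(S) = 𝔼_x[g(x) χ_S(x)]`, characters
`walsh S x = ∏_{i ∈ S} (-1)^{xᵢ}`, level weights `levelWeight g k = W^k[g] = ∑_{|S|=k} ĝ(S)²`.

* `bonami_even_moment` — **Bonami's lemma for even moments** (O'Donnell 2014, Thm. 9.21, "Let
  `f` have degree at most `k`. Then `‖f‖_q ≤ √(q-1)^k ‖f‖₂` for any `q > 2`", here for even
  `q = 2r`, the case going back to Bonami): if `ĝ(S) = 0` whenever `|S| > d`, then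
  `𝔼[g^{2r}] ≤ (2r-1)^{rd} 𝔼[g²]^r`. Proof by the induction on the number of coordinates of
  O'Donnell §9.1 ("The Bonami Lemma", the case `q = 4`): `g(b, y) = a(y) + χ(b) e(y)` with
  `deg a ≤ d`, `deg e ≤ d - 1`; the one-variable step is the binomial estimate
  `C(2r,2i) ≤ (2r-1)^i C(r,i)` (`choose_two_mul_le`), and the mixed moments are bounded by the
  weighted AM–GM inequality in place of Hölder (`avg_pow_mul_pow_le`).
* `levelK_pow_le` — **the level-`k` inequality, moment form**: for `0 ≤ f ≤ 1` with mean
  `α = f̂(∅)` and every `r ≥ 1`, `(W_k[f])^r ≤ α^{2r-1} (2r-1)^{rk}`, `W_k[f] = ∑_{|S|=k} f̂(S)²`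
  (from `W_k = 𝔼[f · f^{=k}]`, the power-mean inequality and Bonami for `f^{=k}`; this is the
  Hölder route to level-`k` bounds, O'Donnell §9.5 obtains them from small-set expansion).
* `levelK_le_log` — **the level-`k` inequality**: `W_k[f] ≤ e α² (2 ln(1/α) + 3)^k` for every
  `k` (`r = ⌈ln(1/α)⌉ + 1`). O'Donnell 2014, §9.5, "Level-k Inequalities": for
  `f : {-1,1}ⁿ → {0,1}` of mean `α` and `k ≤ 2 ln(1/α)`, `W^{≤k}[f] ≤ (2e ln(1/α)/k)^k α²`; the
  version here is weaker in the constant but holds at every level `k`, which is the form needed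
  for Fourier-growth (`L_{1,k} ≤ L^k` for all `k`) arguments.

Everything is a finite sum and is proved; no named facts. Mathlib has no hypercontractivity or
Bonami lemma (searched `Bonami`, `hypercontractiv`, `noise operator`); used from Mathlib:
`Real.geom_mean_le_arith_mean2_weighted` (weighted AM–GM), `Real.pow_arith_mean_le_arith_mean_pow`
(power means), `add_pow`, `Real.exp_log`.

## References

* R. O'Donnell, *Analysis of Boolean Functions*, Cambridge University Press, 2014, §9.1 ("The
  Bonami Lemma"), Thm. 9.21 (`‖f‖_q ≤ √(q-1)^{deg f} ‖f‖₂`), §9.5 ("Level-k Inequalities")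
  [ODonnell2014].
* A. Bonami, *Étude des coefficients de Fourier des fonctions de `L^p(G)`*, Ann. Inst. Fourier 20
  (1970) 335–402 (the even-moment inequality for Walsh–Rademacher polynomials).
-/

noncomputable section

namespace Literature.Computability.Complexity.LowDegree

open Finset Real Literature.Probability.RandomGraphs.LowDegree

variable {m : ℕ}

/-! ### Elementary inequalities for the one-variable step -/

/-- Splitting a sum over `range (2r+1)` into even and odd indices. [folklore] -/
theorem sum_range_two_mul_succ (f : ℕ → ℝ) (r : ℕ) :
    ∑ j ∈ range (2 * r + 1), f j = ∑ i ∈ range (r + 1), f (2 * i) + ∑ i ∈ range r, f (2 * i + 1) := by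
  induction r with
  | zero => simp
  | succ r ih =>
    have h1 : ∑ j ∈ range (2 * (r + 1) + 1), f j =
        ∑ j ∈ range (2 * r + 1), f j + f (2 * r + 1) + f (2 * r + 2) := by
      rw [show 2 * (r + 1) + 1 = (2 * r + 1) + 1 + 1 by ring, sum_range_succ, sum_range_succ]
    have h2 : ∑ i ∈ range (r + 1 + 1), f (2 * i) = ∑ i ∈ range (r + 1), f (2 * i) + f (2 * r + 2) := by
      rw [sum_range_succ, show 2 * (r + 1) = 2 * r + 2 by ring]
    have h3 : ∑ i ∈ range (r + 1), f (2 * i + 1) = ∑ i ∈ range r, f (2 * i + 1) + f (2 * r + 1) := by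
      rw [sum_range_succ]
    rw [h1, h2, h3, ih]
    ring

/-- **The two-point identity**: `((a+e)^{2r} + (a-e)^{2r})/2 = ∑_{i ≤ r} C(2r,2i) a^{2(r-i)} e^{2i}`.
[cite: ODonnell2014, §9.1] -/
theorem two_point_expand (a e : ℝ) (r : ℕ) :
    ((a + e) ^ (2 * r) + (a - e) ^ (2 * r)) / 2 =
      ∑ i ∈ range (r + 1), ((2 * r).choose (2 * i) : ℝ) * (a ^ 2) ^ (r - i) * (e ^ 2) ^ i := by
  have h1 : (a + e) ^ (2 * r) = ∑ j ∈ range (2 * r + 1), e ^ j * a ^ (2 * r - j) * ((2 * r).choose j : ℝ) := by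
    rw [add_comm, add_pow]
  have h2 : (a - e) ^ (2 * r) = ∑ j ∈ range (2 * r + 1), (-e) ^ j * a ^ (2 * r - j) * ((2 * r).choose j : ℝ) := by
    rw [sub_eq_add_neg, add_comm, add_pow]
  rw [h1, h2, ← sum_add_distrib, sum_range_two_mul_succ]
  have hodd : ∑ i ∈ range r, (e ^ (2 * i + 1) * a ^ (2 * r - (2 * i + 1)) * ((2 * r).choose (2 * i + 1) : ℝ) +
      (-e) ^ (2 * i + 1) * a ^ (2 * r - (2 * i + 1)) * ((2 * r).choose (2 * i + 1) : ℝ)) = 0 := by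
    refine sum_eq_zero fun i _ => ?_
    rw [neg_pow, pow_succ (-1 : ℝ) (2 * i), pow_mul, neg_one_sq, one_pow]
    ring
  rw [hodd, add_zero, sum_div]
  refine sum_congr rfl fun i hi => ?_
  have hir : i ≤ r := Nat.lt_succ_iff.1 (mem_range.1 hi)
  rw [neg_pow, pow_mul (-1 : ℝ) 2 i, neg_one_sq, one_pow, one_mul,
    show 2 * r - 2 * i = 2 * (r - i) by omega, pow_mul, pow_mul]
  ring

/-- **The binomial estimate of the one-variable step**: `C(2r, 2i) ≤ (2r-1)^i C(r, i)`
(the coefficientwise comparison behind `𝔼[(a + ρ b x)^{2r}] ≤ (a² + b²)^r`, `ρ² = 1/(2r-1)`).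
[cite: ODonnell2014, §9.1] -/
theorem choose_two_mul_le (r : ℕ) : ∀ i : ℕ, i ≤ r →
    ((2 * r).choose (2 * i) : ℝ) ≤ (2 * r - 1 : ℝ) ^ i * (r.choose i : ℝ)
  | 0, _ => by simp
  | i + 1, hi => by
    have ih := choose_two_mul_le r i (Nat.le_of_succ_le hi)
    -- `C(2r, 2i+2) (2i+2)(2i+1) = C(2r, 2i) (2r-2i)(2r-2i-1)` and `C(r,i+1)(i+1) = C(r,i)(r-i)`
    have e1 : ((2 * r).choose (2 * i + 2) : ℝ) * (2 * i + 2) * (2 * i + 1) =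
        ((2 * r).choose (2 * i) : ℝ) * (2 * r - 2 * i) * (2 * r - 2 * i - 1) := by
      have h1 := Nat.choose_succ_right_eq (2 * r) (2 * i + 1)
      have h2 := Nat.choose_succ_right_eq (2 * r) (2 * i)
      have hsub1 : ((2 * r - (2 * i + 1) : ℕ) : ℝ) = 2 * r - 2 * i - 1 := by
        rw [Nat.cast_sub (by omega)]; push_cast; ring
      have hsub2 : ((2 * r - 2 * i : ℕ) : ℝ) = 2 * r - 2 * i := by
        rw [Nat.cast_sub (by omega)]; push_cast; ring
      have h1' : ((2 * r).choose (2 * i + 2) : ℝ) * (2 * i + 2) = ((2 * r).choose (2 * i + 1) : ℝ) * (2 * r - 2 * i - 1) := by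
        rw [← hsub1]; exact_mod_cast h1
      have h2' : ((2 * r).choose (2 * i + 1) : ℝ) * (2 * i + 1) = ((2 * r).choose (2 * i) : ℝ) * (2 * r - 2 * i) := by
        rw [← hsub2]; exact_mod_cast h2
      linear_combination (2 * i + 1 : ℝ) * h1' + (2 * r - 2 * i - 1 : ℝ) * h2'
    have e2 : (r.choose (i + 1) : ℝ) * (i + 1) = (r.choose i : ℝ) * (r - i) := by
      have h := Nat.choose_succ_right_eq r i
      have hsub : ((r - i : ℕ) : ℝ) = r - i := by rw [Nat.cast_sub (by omega)]
      rw [← hsub]; exact_mod_cast h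
    have hpos : (0 : ℝ) < (2 * i + 2) * (2 * i + 1) := by positivity
    rw [show 2 * (i + 1) = 2 * i + 2 by ring]
    refine le_of_mul_le_mul_right ?_ hpos
    have hri : (0 : ℝ) ≤ r - i := by
      have : (i : ℝ) ≤ r := by exact_mod_cast (Nat.le_of_succ_le hi)
      linarith
    have hr1 : (0 : ℝ) ≤ 2 * r - 1 := by
      have : (1 : ℝ) ≤ r := by exact_mod_cast (le_trans (Nat.succ_le_succ (Nat.zero_le i)) hi)
      linarith
    have hkey : (2 * r - 2 * i - 1 : ℝ) ≤ (2 * r - 1) * (2 * i + 1) := by nlinarith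
    calc ((2 * r).choose (2 * i + 2) : ℝ) * ((2 * i + 2) * (2 * i + 1))
        = ((2 * r).choose (2 * i) : ℝ) * (2 * r - 2 * i) * (2 * r - 2 * i - 1) := by rw [← e1]; ring
      _ ≤ ((2 * r - 1) ^ i * (r.choose i : ℝ)) * (2 * r - 2 * i) * (2 * r - 2 * i - 1) := by
          have h0 : (0 : ℝ) ≤ (2 * r - 2 * i) * (2 * r - 2 * i - 1) := by
            rcases Nat.lt_or_ge i r with h | h
            · have : (i : ℝ) + 1 ≤ r := by exact_mod_cast h
              nlinarith
            · have : r = i := le_antisymm h (Nat.le_of_succ_le hi)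
              subst this
              norm_num
          calc _ = ((2 * r).choose (2 * i) : ℝ) * ((2 * r - 2 * i) * (2 * r - 2 * i - 1)) := by ring
            _ ≤ ((2 * r - 1) ^ i * (r.choose i : ℝ)) * ((2 * r - 2 * i) * (2 * r - 2 * i - 1)) :=
                mul_le_mul_of_nonneg_right ih h0
            _ = _ := by ring
      _ = (2 * r - 1) ^ i * 2 * ((r.choose i : ℝ) * (r - i)) * (2 * r - 2 * i - 1) := by ring
      _ = (2 * r - 1) ^ i * 2 * ((r.choose (i + 1) : ℝ) * (i + 1)) * (2 * r - 2 * i - 1) := by rw [e2]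
      _ ≤ (2 * r - 1) ^ i * 2 * ((r.choose (i + 1) : ℝ) * (i + 1)) * ((2 * r - 1) * (2 * i + 1)) :=
          mul_le_mul_of_nonneg_left hkey (by positivity)
      _ = (2 * r - 1) ^ (i + 1) * (r.choose (i + 1) : ℝ) * ((2 * i + 2) * (2 * i + 1)) := by ring

/-- **The one-variable inequality** (O'Donnell 2014, §9.1, the case `n = 1` of the Bonami lemma,
in squared variables): for `P, Q ≥ 0`, `∑_{i ≤ r} C(2r,2i) P^{r-i} Q^i ≤ (P + (2r-1) Q)^r`.
[cite: ODonnell2014, §9.1] -/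
theorem sum_choose_two_mul_le (r : ℕ) {P Q : ℝ} (hP : 0 ≤ P) (hQ : 0 ≤ Q) :
    ∑ i ∈ range (r + 1), ((2 * r).choose (2 * i) : ℝ) * P ^ (r - i) * Q ^ i ≤
      (P + (2 * r - 1) * Q) ^ r := by
  rw [add_comm P, add_pow]
  refine sum_le_sum fun i hi => ?_
  have hir : i ≤ r := Nat.lt_succ_iff.1 (mem_range.1 hi)
  rw [mul_pow]
  calc ((2 * r).choose (2 * i) : ℝ) * P ^ (r - i) * Q ^ i
      ≤ ((2 * r - 1) ^ i * (r.choose i : ℝ)) * P ^ (r - i) * Q ^ i := by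
        have h0 : 0 ≤ P ^ (r - i) * Q ^ i := by positivity
        calc _ = ((2 * r).choose (2 * i) : ℝ) * (P ^ (r - i) * Q ^ i) := by ring
          _ ≤ ((2 * r - 1) ^ i * (r.choose i : ℝ)) * (P ^ (r - i) * Q ^ i) :=
              mul_le_mul_of_nonneg_right (choose_two_mul_le r i hir) h0
          _ = _ := by ring
    _ = (2 * r - 1) ^ i * Q ^ i * P ^ (r - i) * (r.choose i : ℝ) := by ring

/-- **Weighted AM–GM in place of Hölder**: if `𝔼[a^{2r}] ≤ P^r` and `𝔼[e^{2r}] ≤ Q^r` then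
`𝔼[a^{2(r-i)} e^{2i}] ≤ P^{r-i} Q^i` (`0 < i < r`; pointwise
`u^{1-λ} v^{λ} ≤ (1-λ)u + λv` with `λ = i/r`, `u = a^{2r}/P^r`, `v = e^{2r}/Q^r`, then average).
[cite: ODonnell2014, §9.1] -/
theorem avg_pow_mul_pow_le {ι : Type*} [Fintype ι] (a e : ι → ℝ) {r i : ℕ} (hi0 : 0 < i)
    (hir : i < r) {P Q N : ℝ} (hP : 0 ≤ P) (hQ : 0 ≤ Q) (hN : 0 < N)
    (ha : (∑ y, (a y ^ 2) ^ r) / N ≤ P ^ r) (he : (∑ y, (e y ^ 2) ^ r) / N ≤ Q ^ r) :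
    (∑ y, (a y ^ 2) ^ (r - i) * (e y ^ 2) ^ i) / N ≤ P ^ (r - i) * Q ^ i := by
  have hr0 : 0 < r := lt_of_le_of_lt (Nat.zero_le i) hir
  have hri0 : 0 < r - i := Nat.sub_pos_of_lt hir
  -- degenerate cases `P = 0` / `Q = 0`
  rcases hP.eq_or_lt with hP0 | hPpos
  · subst hP0
    have hsum : ∑ y, (a y ^ 2) ^ r ≤ 0 := by
      rw [zero_pow hr0.ne'] at ha
      rwa [div_le_iff₀ hN, zero_mul] at ha
    have hzero : ∀ y, a y ^ 2 = 0 := by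
      intro y
      have hle := (sum_eq_zero_iff_of_nonneg fun y _ => by positivity).1
        (le_antisymm hsum (sum_nonneg fun y _ => by positivity)) y (mem_univ y)
      exact pow_eq_zero_iff hr0.ne' |>.1 hle
    rw [zero_pow hri0.ne', zero_mul]
    refine le_of_eq ?_
    rw [div_eq_zero_iff]
    exact Or.inl (sum_eq_zero fun y _ => by rw [hzero y, zero_pow hri0.ne', zero_mul])
  rcases hQ.eq_or_lt with hQ0 | hQpos
  · subst hQ0
    have hsum : ∑ y, (e y ^ 2) ^ r ≤ 0 := by
      rw [zero_pow hr0.ne'] at he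
      rwa [div_le_iff₀ hN, zero_mul] at he
    have hzero : ∀ y, e y ^ 2 = 0 := by
      intro y
      have hle := (sum_eq_zero_iff_of_nonneg fun y _ => by positivity).1
        (le_antisymm hsum (sum_nonneg fun y _ => by positivity)) y (mem_univ y)
      exact pow_eq_zero_iff hr0.ne' |>.1 hle
    rw [zero_pow hi0.ne', mul_zero]
    refine le_of_eq ?_
    rw [div_eq_zero_iff]
    exact Or.inl (sum_eq_zero fun y _ => by rw [hzero y, zero_pow hi0.ne', mul_zero])
  -- main case: pointwise weighted AM–GM
  set w₁ : ℝ := ((r - i : ℕ) : ℝ) / r with hw₁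
  set w₂ : ℝ := (i : ℝ) / r with hw₂
  have hrpos : (0 : ℝ) < r := by exact_mod_cast hr0
  have hw₁0 : 0 ≤ w₁ := by positivity
  have hw₂0 : 0 ≤ w₂ := by positivity
  have hw : w₁ + w₂ = 1 := by
    rw [hw₁, hw₂, ← add_div, div_eq_one_iff_eq hrpos.ne', Nat.cast_sub hir.le]
    ring
  have hpt : ∀ y, (a y ^ 2) ^ (r - i) * (e y ^ 2) ^ i ≤
      P ^ (r - i) * Q ^ i * (w₁ * ((a y ^ 2) ^ r / P ^ r) + w₂ * ((e y ^ 2) ^ r / Q ^ r)) := by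
    intro y
    set u : ℝ := a y ^ 2 / P with hu
    set v : ℝ := e y ^ 2 / Q with hv
    have hu0 : 0 ≤ u := by positivity
    have hv0 : 0 ≤ v := by positivity
    have hamgm := geom_mean_le_arith_mean2_weighted hw₁0 hw₂0 (pow_nonneg hu0 r) (pow_nonneg hv0 r) hw
    -- `(u^r)^{w₁} = u^{r-i}`, `(v^r)^{w₂} = v^i`
    have e1 : (u ^ r) ^ w₁ = u ^ (r - i) := by
      rw [← rpow_natCast u r, ← rpow_mul hu0, hw₁, mul_div_cancel₀ _ hrpos.ne', rpow_natCast]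
    have e2 : (v ^ r) ^ w₂ = v ^ i := by
      rw [← rpow_natCast v r, ← rpow_mul hv0, hw₂, mul_div_cancel₀ _ hrpos.ne', rpow_natCast]
    rw [e1, e2] at hamgm
    have eu : ∀ k : ℕ, u ^ k * P ^ k = (a y ^ 2) ^ k := fun k => by
      rw [hu, div_pow, div_mul_cancel₀ _ (pow_ne_zero k hPpos.ne')]
    have ev : ∀ k : ℕ, v ^ k * Q ^ k = (e y ^ 2) ^ k := fun k => by
      rw [hv, div_pow, div_mul_cancel₀ _ (pow_ne_zero k hQpos.ne')]
    have hur : (a y ^ 2) ^ r / P ^ r = u ^ r := by rw [hu, div_pow]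
    have hvr : (e y ^ 2) ^ r / Q ^ r = v ^ r := by rw [hv, div_pow]
    rw [hur, hvr, ← eu (r - i), ← ev i]
    calc u ^ (r - i) * P ^ (r - i) * (v ^ i * Q ^ i) = (P ^ (r - i) * Q ^ i) * (u ^ (r - i) * v ^ i) := by ring
      _ ≤ (P ^ (r - i) * Q ^ i) * (w₁ * u ^ r + w₂ * v ^ r) :=
          mul_le_mul_of_nonneg_left hamgm (by positivity)
  have hsum : ∑ y, (a y ^ 2) ^ (r - i) * (e y ^ 2) ^ i ≤
      P ^ (r - i) * Q ^ i * (w₁ * ((∑ y, (a y ^ 2) ^ r) / P ^ r) + w₂ * ((∑ y, (e y ^ 2) ^ r) / Q ^ r)) := by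
    calc _ ≤ ∑ y, P ^ (r - i) * Q ^ i * (w₁ * ((a y ^ 2) ^ r / P ^ r) + w₂ * ((e y ^ 2) ^ r / Q ^ r)) :=
          sum_le_sum fun y _ => hpt y
      _ = _ := by
          rw [← mul_sum, sum_add_distrib, ← mul_sum, ← mul_sum, sum_div, sum_div]
  rw [div_le_iff₀ hN]
  have hPr : 0 < P ^ r := pow_pos hPpos r
  have hQr : 0 < Q ^ r := pow_pos hQpos r
  have ha' : (∑ y, (a y ^ 2) ^ r) / P ^ r ≤ N := by
    rw [div_le_iff₀ hPr]; rw [div_le_iff₀ hN] at ha; linarith [mul_comm N (P ^ r)]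
  have he' : (∑ y, (e y ^ 2) ^ r) / Q ^ r ≤ N := by
    rw [div_le_iff₀ hQr]; rw [div_le_iff₀ hN] at he; linarith [mul_comm N (Q ^ r)]
  calc _ ≤ P ^ (r - i) * Q ^ i * (w₁ * ((∑ y, (a y ^ 2) ^ r) / P ^ r) + w₂ * ((∑ y, (e y ^ 2) ^ r) / Q ^ r)) := hsum
    _ ≤ P ^ (r - i) * Q ^ i * (w₁ * N + w₂ * N) := by
        refine mul_le_mul_of_nonneg_left ?_ (by positivity)
        exact add_le_add (mul_le_mul_of_nonneg_left ha' hw₁0) (mul_le_mul_of_nonneg_left he' hw₂0)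
    _ = P ^ (r - i) * Q ^ i * N := by rw [← add_mul, hw, one_mul]

/-! ### Splitting off the first coordinate -/

/-- The even part of `g` in the first coordinate: `a(y) = (g(0,y) + g(1,y))/2`. [cite: ODonnell2014, §9.1] -/
def halfSum (g : (Fin (m + 1) → Bool) → ℝ) (y : Fin m → Bool) : ℝ :=
  (g (Fin.cons false y) + g (Fin.cons true y)) / 2

/-- The odd part of `g` in the first coordinate: `e(y) = (g(0,y) - g(1,y))/2`. [cite: ODonnell2014, §9.1] -/
def halfDiff (g : (Fin (m + 1) → Bool) → ℝ) (y : Fin m → Bool) : ℝ :=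
  (g (Fin.cons false y) - g (Fin.cons true y)) / 2

/-- `g(b, y) = a(y) + χ(b) e(y)`. [cite: ODonnell2014, §9.1] -/
theorem apply_cons_eq (g : (Fin (m + 1) → Bool) → ℝ) (b : Bool) (y : Fin m → Bool) :
    g (Fin.cons b y) = halfSum g y + sgn b * halfDiff g y := by
  cases b <;> simp [halfSum, halfDiff, sgn] <;> ring

/-- Summing over `{0,1}^{m+1}` by the first coordinate. [folklore] -/
theorem sum_cube_succ (F : (Fin (m + 1) → Bool) → ℝ) :
    ∑ x, F x = ∑ y : Fin m → Bool, (F (Fin.cons false y) + F (Fin.cons true y)) := by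
  rw [← Fintype.sum_equiv (Fin.consEquiv fun _ : Fin (m + 1) => Bool) (fun p => F (Fin.cons p.1 p.2)) F
    (fun p => rfl), Fintype.sum_prod_type, Fintype.sum_bool]
  rw [← sum_add_distrib]
  refine sum_congr rfl fun y _ => ?_
  ring

/-- A character not involving the first coordinate, at `(b, y)`. [folklore] -/
theorem walsh_map_succEmb_cons (T : Finset (Fin m)) (b : Bool) (y : Fin m → Bool) :
    walsh (T.map (Fin.succEmb m)) (Fin.cons b y : Fin (m + 1) → Bool) = walsh T y := by
  unfold walsh
  rw [prod_map]
  refine prod_congr rfl fun i _ => ?_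
  simp

/-- A character involving the first coordinate, at `(b, y)`. [folklore] -/
theorem walsh_insert_zero_cons (T : Finset (Fin m)) (b : Bool) (y : Fin m → Bool) :
    walsh (insert 0 (T.map (Fin.succEmb m))) (Fin.cons b y : Fin (m + 1) → Bool) = sgn b * walsh T y := by
  have h0 : (0 : Fin (m + 1)) ∉ T.map (Fin.succEmb m) := by
    simp only [mem_map, Fin.coe_succEmb, not_exists, not_and]
    exact fun i _ => Fin.succ_ne_zero i
  unfold walsh
  rw [prod_insert h0, Fin.cons_zero]
  congr 1
  rw [prod_map]
  refine prod_congr rfl fun i _ => ?_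
  simp

/-- **Coefficients of the even part**: `â(T) = ĝ(T⁺)`, `T⁺ = succ(T)`. [cite: ODonnell2014, §9.1] -/
theorem cubeFourierCoeff_halfSum (g : (Fin (m + 1) → Bool) → ℝ) (T : Finset (Fin m)) :
    cubeFourierCoeff (halfSum g) T = cubeFourierCoeff g (T.map (Fin.succEmb m)) := by
  unfold cubeFourierCoeff
  rw [sum_cube_succ]
  simp_rw [walsh_map_succEmb_cons]
  have h : ∑ x, halfSum g x * walsh T x =
      (∑ x, (g (Fin.cons false x) * walsh T x + g (Fin.cons true x) * walsh T x)) / 2 := by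
    rw [Finset.sum_div]
    refine sum_congr rfl fun y _ => ?_
    simp only [halfSum]
    ring
  rw [h, pow_succ', div_div]

/-- **Coefficients of the odd part**: `ê(T) = ĝ({0} ∪ T⁺)`. [cite: ODonnell2014, §9.1] -/
theorem cubeFourierCoeff_halfDiff (g : (Fin (m + 1) → Bool) → ℝ) (T : Finset (Fin m)) :
    cubeFourierCoeff (halfDiff g) T = cubeFourierCoeff g (insert 0 (T.map (Fin.succEmb m))) := by
  unfold cubeFourierCoeff
  rw [sum_cube_succ]
  simp_rw [walsh_insert_zero_cons]
  have h : ∑ x, halfDiff g x * walsh T x =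
      (∑ x, (g (Fin.cons false x) * (sgn false * walsh T x) +
        g (Fin.cons true x) * (sgn true * walsh T x))) / 2 := by
    rw [Finset.sum_div]
    refine sum_congr rfl fun y _ => ?_
    simp only [halfDiff, sgn, if_true, if_false, Bool.false_eq_true]
    ring
  rw [h, pow_succ', div_div]

/-- The card of `{0} ∪ T⁺` is `|T| + 1`. [folklore] -/
theorem card_insert_zero_map_succEmb (T : Finset (Fin m)) :
    (insert 0 (T.map (Fin.succEmb m))).card = T.card + 1 := by
  rw [card_insert_of_notMem, card_map]
  simp only [mem_map, Fin.coe_succEmb, not_exists, not_and]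
  exact fun i _ => Fin.succ_ne_zero i

/-- A function all of whose coefficients vanish is zero (inversion). [cite: ODonnell2014, Thm 1.1] -/
theorem eq_zero_of_cubeFourierCoeff_eq_zero (g : (Fin m → Bool) → ℝ)
    (h : ∀ S, cubeFourierCoeff g S = 0) (x : Fin m → Bool) : g x = 0 := by
  rw [← sum_cubeFourierCoeff_mul_walsh g x]
  exact sum_eq_zero fun S _ => by rw [h S, zero_mul]

/-! ### Bonami's lemma for even moments -/

/-- **Bonami's lemma (even moments).** If `ĝ(S) = 0` whenever `|S| > d` then for every `r ≥ 1`,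
`𝔼[g^{2r}] ≤ (2r - 1)^{rd} (𝔼[g²])^r`, i.e. `‖g‖_{2r} ≤ √(2r-1)^{d} ‖g‖₂`
(O'Donnell 2014, Thm. 9.21 with `q = 2r`; Bonami 1970). Proof by induction on the number of
coordinates: `g(b,y) = a(y) + χ(b) e(y)` with `deg a ≤ d`, `deg e ≤ d - 1`;
`𝔼_b[g^{2r}] = ∑_i C(2r,2i) a^{2(r-i)} e^{2i}`, each mixed moment is at most `P^{r-i} Q^i`
(`P = (2r-1)^d 𝔼[a²]`, `Q = (2r-1)^{d-1} 𝔼[e²]`, weighted AM–GM and the induction hypothesis),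
and `∑_i C(2r,2i) P^{r-i} Q^i ≤ (P + (2r-1)Q)^r = ((2r-1)^d 𝔼[g²])^r`. [cite: ODonnell2014, Thm. 9.21] -/
theorem bonami_even_moment : ∀ {m : ℕ} (d : ℕ) (g : (Fin m → Bool) → ℝ)
    (_hg : ∀ S : Finset (Fin m), d < S.card → cubeFourierCoeff g S = 0) (r : ℕ) (_hr : 1 ≤ r),
    (∑ x, (g x ^ 2) ^ r) / 2 ^ m ≤ (2 * r - 1 : ℝ) ^ (r * d) * ((∑ x, g x ^ 2) / 2 ^ m) ^ r
  | 0, d, g, hg, r, hr => by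
    have h1 : (1 : ℝ) ≤ (2 * r - 1 : ℝ) ^ (r * d) := by
      refine one_le_pow₀ ?_
      have : (1 : ℝ) ≤ r := by exact_mod_cast hr
      linarith
    simp only [pow_zero, div_one, Finset.univ_unique, sum_singleton]
    exact le_mul_of_one_le_left (by positivity) h1
  | m + 1, d, g, hg, r, hr => by
    set a := halfSum g with ha_def
    set e := halfDiff g with he_def
    -- degrees of the two parts
    have hdega : ∀ T : Finset (Fin m), d < T.card → cubeFourierCoeff a T = 0 := by
      intro T hT
      rw [ha_def, cubeFourierCoeff_halfSum]
      exact hg _ (by rwa [card_map])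
    have hdege : ∀ T : Finset (Fin m), d - 1 < T.card → 1 ≤ d → cubeFourierCoeff e T = 0 := by
      intro T hT hd
      rw [he_def, cubeFourierCoeff_halfDiff]
      exact hg _ (by rw [card_insert_zero_map_succEmb]; omega)
    have hr0 : 0 < r := hr
    have h2r1 : (1 : ℝ) ≤ 2 * r - 1 := by
      have : (1 : ℝ) ≤ r := by exact_mod_cast hr
      linarith
    have h2r0 : (0 : ℝ) ≤ 2 * r - 1 := le_trans zero_le_one h2r1
    have hN : (0 : ℝ) < 2 ^ m := by positivity
    -- second moments
    have hsq : ∑ x, g x ^ 2 = 2 * ∑ y, (a y ^ 2 + e y ^ 2) := by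
      rw [sum_cube_succ, mul_sum]
      refine sum_congr rfl fun y _ => ?_
      rw [apply_cons_eq g false y, apply_cons_eq g true y]
      simp only [sgn, if_true, if_false, Bool.false_eq_true]
      ring
    -- `2r`-th moments through the two-point identity
    have hmom : ∑ x, (g x ^ 2) ^ r =
        2 * ∑ i ∈ range (r + 1), ((2 * r).choose (2 * i) : ℝ) * ∑ y, (a y ^ 2) ^ (r - i) * (e y ^ 2) ^ i := by
      rw [sum_cube_succ]
      have key : ∀ y : Fin m → Bool, (g (Fin.cons false y) ^ 2) ^ r + (g (Fin.cons true y) ^ 2) ^ r =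
          2 * ∑ i ∈ range (r + 1), ((2 * r).choose (2 * i) : ℝ) * ((a y ^ 2) ^ (r - i) * (e y ^ 2) ^ i) := by
        intro y
        rw [apply_cons_eq g false y, apply_cons_eq g true y]
        simp only [sgn, if_false, if_true, one_mul, neg_one_mul, ← sub_eq_add_neg, Bool.false_eq_true]
        rw [← pow_mul, ← pow_mul]
        have h := two_point_expand (a y) (e y) r
        rw [div_eq_iff (two_ne_zero)] at h
        rw [h, mul_comm]
        congr 1
        exact sum_congr rfl fun i _ => by ring
      simp_rw [key]
      rw [← mul_sum, sum_comm]
      simp_rw [← mul_sum]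
    -- the induction hypothesis for `a` (degree `d`) and `e` (degree `d - 1`)
    set P : ℝ := (2 * r - 1 : ℝ) ^ d * ((∑ y, a y ^ 2) / 2 ^ m) with hP_def
    set Q : ℝ := (2 * r - 1 : ℝ) ^ (d - 1) * ((∑ y, e y ^ 2) / 2 ^ m) with hQ_def
    have hP0 : 0 ≤ P :=
      mul_nonneg (pow_nonneg h2r0 _) (div_nonneg (sum_nonneg fun y _ => by positivity) hN.le)
    have hQ0 : 0 ≤ Q :=
      mul_nonneg (pow_nonneg h2r0 _) (div_nonneg (sum_nonneg fun y _ => by positivity) hN.le)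
    have iha : (∑ y, (a y ^ 2) ^ r) / 2 ^ m ≤ P ^ r := by
      have h := bonami_even_moment d a hdega r hr
      rw [hP_def, mul_pow, ← pow_mul, mul_comm d r]
      exact h
    -- case `d = 0`: `e = 0`
    rcases Nat.eq_zero_or_pos d with hd0 | hdpos
    · subst hd0
      have he0 : ∀ y, e y = 0 := by
        refine eq_zero_of_cubeFourierCoeff_eq_zero e fun T => ?_
        rw [he_def, cubeFourierCoeff_halfDiff]
        exact hg _ (by rw [card_insert_zero_map_succEmb]; omega)
      have hmom' : ∑ x, (g x ^ 2) ^ r = 2 * ∑ y, (a y ^ 2) ^ r := by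
        rw [sum_cube_succ, mul_sum]
        refine sum_congr rfl fun y _ => ?_
        rw [apply_cons_eq g false y, apply_cons_eq g true y, ← ha_def, ← he_def, he0 y]
        ring
      have hsq' : ∑ x, g x ^ 2 = 2 * ∑ y, a y ^ 2 := by
        rw [hsq]; congr 1; exact sum_congr rfl fun y _ => by rw [he0 y]; ring
      rw [hmom', hsq', pow_succ', mul_div_mul_left _ _ (two_ne_zero' ℝ),
        mul_div_mul_left _ _ (two_ne_zero' ℝ)]
      simpa [hP_def] using iha
    -- case `d ≥ 1`
    have ihe : (∑ y, (e y ^ 2) ^ r) / 2 ^ m ≤ Q ^ r := by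
      have h := bonami_even_moment (d - 1) e (fun T hT => hdege T hT hdpos) r hr
      rw [hQ_def, mul_pow, ← pow_mul, mul_comm (d - 1) r]
      exact h
    -- each mixed moment is at most `P^{r-i} Q^i`
    have hmixed : ∀ i ∈ range (r + 1),
        ((2 * r).choose (2 * i) : ℝ) * ((∑ y, (a y ^ 2) ^ (r - i) * (e y ^ 2) ^ i) / 2 ^ m) ≤
          ((2 * r).choose (2 * i) : ℝ) * P ^ (r - i) * Q ^ i := by
      intro i hi
      have hir : i ≤ r := Nat.lt_succ_iff.1 (mem_range.1 hi)
      rw [mul_assoc]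
      refine mul_le_mul_of_nonneg_left ?_ (Nat.cast_nonneg _)
      rcases Nat.eq_zero_or_pos i with rfl | hi0
      · simpa using iha
      rcases hir.lt_or_eq with hlt | rfl
      · exact avg_pow_mul_pow_le a e hi0 hlt hP0 hQ0 hN iha ihe
      · simpa using ihe
    -- assemble
    have hfinal : (∑ x, (g x ^ 2) ^ r) / 2 ^ (m + 1) ≤ (P + (2 * r - 1) * Q) ^ r := by
      rw [hmom, pow_succ', mul_div_mul_left _ _ (two_ne_zero' ℝ), sum_div]
      calc ∑ i ∈ range (r + 1), ((2 * r).choose (2 * i) : ℝ) * (∑ y, (a y ^ 2) ^ (r - i) * (e y ^ 2) ^ i) / 2 ^ m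
          = ∑ i ∈ range (r + 1), ((2 * r).choose (2 * i) : ℝ) * ((∑ y, (a y ^ 2) ^ (r - i) * (e y ^ 2) ^ i) / 2 ^ m) :=
            sum_congr rfl fun i _ => mul_div_assoc _ _ _
        _ ≤ ∑ i ∈ range (r + 1), ((2 * r).choose (2 * i) : ℝ) * P ^ (r - i) * Q ^ i := sum_le_sum hmixed
        _ ≤ (P + (2 * r - 1) * Q) ^ r := sum_choose_two_mul_le r hP0 hQ0
    have hPQ : P + (2 * r - 1) * Q = (2 * r - 1 : ℝ) ^ d * ((∑ x, g x ^ 2) / 2 ^ (m + 1)) := by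
      rw [hsq, pow_succ', mul_div_mul_left _ _ (two_ne_zero' ℝ), hP_def, hQ_def,
        sum_add_distrib, add_div, mul_add]
      congr 1
      obtain ⟨d', rfl⟩ := Nat.exists_eq_add_of_le hdpos
      rw [show 1 + d' - 1 = d' by omega, add_comm 1 d', pow_succ]
      ring
    calc (∑ x, (g x ^ 2) ^ r) / 2 ^ (m + 1) ≤ (P + (2 * r - 1) * Q) ^ r := hfinal
      _ = ((2 * r - 1 : ℝ) ^ d * ((∑ x, g x ^ 2) / 2 ^ (m + 1))) ^ r := by rw [hPQ]
      _ = (2 * r - 1 : ℝ) ^ (r * d) * ((∑ x, g x ^ 2) / 2 ^ (m + 1)) ^ r := by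
          rw [mul_pow, ← pow_mul, mul_comm d r]

/-! ### The level-`k` inequalities -/

/-- **The coefficients of a Walsh sum `∑_S c(S) χ_S` are the prescribed ones** (orthogonality;
the same computation as `Literature.Barriers.QuantumAdvantage.cubeFourierCoeff_fourierFn`, kept
local to avoid importing a barrier file into this infrastructure file). [cite: ODonnell2014, §1.4] -/
theorem cubeFourierCoeff_sum_mul_walsh (c : Finset (Fin m) → ℝ) (T : Finset (Fin m)) :
    cubeFourierCoeff (fun x => ∑ S, c S * walsh S x) T = c T := by
  unfold cubeFourierCoeff
  simp_rw [sum_mul]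
  rw [sum_comm]
  have e : ∀ S : Finset (Fin m), ∑ x : Fin m → Bool, c S * walsh S x * walsh T x =
      c S * ∑ x : Fin m → Bool, walsh S x * walsh T x := fun S => by
    rw [mul_sum]; exact sum_congr rfl fun x _ => by ring
  simp_rw [e, sum_walsh_mul_walsh_index, mul_ite, mul_zero]
  rw [sum_ite_eq' univ T]
  simp only [mem_univ, if_true]
  have h2 : (2 : ℝ) ^ m ≠ 0 := by positivity
  field_simp

/-- `𝔼[f · ∑_S c(S) χ_S] = ∑_S c(S) f̂(S)`. [cite: ODonnell2014, §1.4] -/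
theorem avg_mul_sum_mul_walsh (f : (Fin m → Bool) → ℝ) (c : Finset (Fin m) → ℝ) :
    (∑ x, f x * ∑ S, c S * walsh S x) / 2 ^ m = ∑ S, c S * cubeFourierCoeff f S := by
  unfold cubeFourierCoeff
  simp_rw [mul_sum]
  rw [sum_comm, sum_div]
  refine sum_congr rfl fun S _ => ?_
  rw [mul_div_assoc', mul_sum]
  congr 1
  exact sum_congr rfl fun x _ => by ring

/-- Level weights are nonnegative. [folklore] -/
theorem levelWeight_nonneg (f : (Fin m → Bool) → ℝ) (k : ℕ) : 0 ≤ levelWeight f k :=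
  sum_nonneg fun _ _ => sq_nonneg _

/-- **The level-`k` inequality, moment form** (O'Donnell 2014, §9.5, proof of the Level-`k`
Inequalities): for `0 ≤ f ≤ 1` with mean `α = f̂(∅)` and every `r ≥ 1`,
`W_k[f]^r ≤ α^{2r-1} (2r-1)^{rk}`. Proof as printed with `q = 2r`: `W_k = 𝔼[f · f^{=k}]`,
`𝔼[f |g|]^{2r} ≤ α^{2r-1} 𝔼[g^{2r}]` (power means for the probability vector `f/(2^m α)` and
`f ≤ 1`), and Bonami for `g = f^{=k}` (`𝔼[g^{2r}] ≤ (2r-1)^{rk} W_k^r`). [cite: ODonnell2014, §9.5] -/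
theorem levelK_pow_le (f : (Fin m → Bool) → ℝ) (hf0 : ∀ x, 0 ≤ f x) (hf1 : ∀ x, f x ≤ 1)
    (k r : ℕ) (hr : 1 ≤ r) :
    levelWeight f k ^ r ≤ cubeFourierCoeff f ∅ ^ (2 * r - 1) * (2 * r - 1 : ℝ) ^ (r * k) := by
  classical
  set α : ℝ := cubeFourierCoeff f ∅ with hα_def
  set W : ℝ := levelWeight f k with hW_def
  -- the level-`k` part `g = f^{=k}`
  set c : Finset (Fin m) → ℝ := fun S => if S.card = k then cubeFourierCoeff f S else 0 with hc_def
  set g : (Fin m → Bool) → ℝ := fun x => ∑ S, c S * walsh S x with hg_def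
  have hN : (0 : ℝ) < 2 ^ m := by positivity
  have hα : α = (∑ x, f x) / 2 ^ m := by rw [hα_def, cubeFourierCoeff_empty]
  have hα0 : 0 ≤ α := by rw [hα]; exact div_nonneg (sum_nonneg fun x _ => hf0 x) hN.le
  have hW0 : 0 ≤ W := levelWeight_nonneg f k
  have hr0 : 0 < r := hr
  have h2r0 : (0 : ℝ) ≤ 2 * r - 1 := by
    have : (1 : ℝ) ≤ r := by exact_mod_cast hr
    linarith
  -- `W = ∑_S c(S) f̂(S) = ∑_S c(S)²`
  have hWc : W = ∑ S, c S * cubeFourierCoeff f S := by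
    rw [hW_def, levelWeight, hc_def]
    simp_rw [ite_mul, zero_mul]
    rw [sum_ite, sum_const_zero, add_zero]
    refine sum_congr ?_ fun S _ => by ring
    ext S; simp [mem_powersetCard]
  have hWc2 : W = ∑ S, c S ^ 2 := by
    rw [hWc]; refine sum_congr rfl fun S _ => ?_
    simp only [hc_def]; split_ifs <;> ring
  -- (1) `W = 𝔼[f g]`
  have h1 : (∑ x, f x * g x) / 2 ^ m = W := by rw [hg_def, avg_mul_sum_mul_walsh, hWc]
  -- (2) `𝔼[g²] = W` (Parseval) and `deg g ≤ k`
  have hcoef : ∀ T, cubeFourierCoeff g T = c T := cubeFourierCoeff_sum_mul_walsh c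
  have h2 : (∑ x, g x ^ 2) / 2 ^ m = W := by
    rw [← sum_cubeFourierCoeff_sq, hWc2]
    exact sum_congr rfl fun S _ => by rw [hcoef]
  have hdeg : ∀ S : Finset (Fin m), k < S.card → cubeFourierCoeff g S = 0 := by
    intro S hS; rw [hcoef, hc_def]; simp [hS.ne']
  -- (3) Bonami
  have h3 : (∑ x, (g x ^ 2) ^ r) / 2 ^ m ≤ (2 * r - 1 : ℝ) ^ (r * k) * W ^ r := by
    have := bonami_even_moment k g hdeg r hr
    rwa [h2] at this
  -- (4) power means: `𝔼[f|g|]^{2r} ≤ α^{2r-1} 𝔼[g^{2r}]`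
  rcases hα0.eq_or_lt with hαz | hαpos
  · -- `α = 0`: `f = 0`, `W = 0`
    have hf : ∀ x, f x = 0 := by
      intro x
      have hs : ∑ x, f x = 0 := by
        have := hαz.symm; rw [hα, div_eq_zero_iff] at this
        exact this.resolve_right hN.ne'
      exact (sum_eq_zero_iff_of_nonneg fun x _ => hf0 x).1 hs x (mem_univ x)
    have hW : W = 0 := by
      rw [← h1]; simp [hf]
    rw [hW, ← hαz, zero_pow hr0.ne', zero_pow (by omega : 2 * r - 1 ≠ 0), zero_mul]
  have h4 : ((∑ x, f x * |g x|) / 2 ^ m) ^ (2 * r) ≤ α ^ (2 * r - 1) * ((∑ x, (g x ^ 2) ^ r) / 2 ^ m) := by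
    -- weights `w x = f x / (2^m α)`
    set w : (Fin m → Bool) → ℝ := fun x => f x / (2 ^ m * α) with hw_def
    have hw0 : ∀ x ∈ (univ : Finset (Fin m → Bool)), 0 ≤ w x :=
      fun x _ => div_nonneg (hf0 x) (by positivity)
    have hw1 : ∑ x, w x = 1 := by
      rw [hw_def]; simp only; rw [← sum_div, div_eq_one_iff_eq (by positivity)]
      rw [hα]; field_simp
    have hpm := pow_arith_mean_le_arith_mean_pow univ w (fun x => |g x|) hw0 hw1
      (fun x _ => abs_nonneg _) (2 * r)
    have e1 : ∑ x, w x * |g x| = ((∑ x, f x * |g x|) / 2 ^ m) / α := by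
      simp only [hw_def]
      rw [div_div, Finset.sum_div]
      exact sum_congr rfl fun x _ => by ring
    have e2 : ∑ x, w x * |g x| ^ (2 * r) ≤ ((∑ x, (g x ^ 2) ^ r) / 2 ^ m) / α := by
      simp only [hw_def]
      rw [div_div, Finset.sum_div]
      refine sum_le_sum fun x _ => ?_
      rw [pow_mul, sq_abs, div_mul_eq_mul_div]
      refine div_le_div_of_nonneg_right ?_ (by positivity)
      exact mul_le_of_le_one_left (by positivity) (hf1 x)
    rw [e1] at hpm
    have h := hpm.trans e2
    rw [div_pow, div_le_div_iff₀ (pow_pos hαpos _) hαpos] at h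
    calc ((∑ x, f x * |g x|) / 2 ^ m) ^ (2 * r)
        = ((∑ x, f x * |g x|) / 2 ^ m) ^ (2 * r) * α / α := by rw [mul_div_cancel_right₀ _ hαpos.ne']
      _ ≤ ((∑ x, (g x ^ 2) ^ r) / 2 ^ m) * α ^ (2 * r) / α := div_le_div_of_nonneg_right h hαpos.le
      _ = α ^ (2 * r - 1) * ((∑ x, (g x ^ 2) ^ r) / 2 ^ m) := by
          obtain ⟨s, hs⟩ : ∃ s, 2 * r = s + 1 := ⟨2 * r - 1, by omega⟩
          rw [hs, Nat.add_sub_cancel, pow_succ]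
          field_simp
  -- (5) `W ≤ 𝔼[f|g|]`, assemble
  have h5 : W ≤ (∑ x, f x * |g x|) / 2 ^ m := by
    rw [← h1]
    exact div_le_div_of_nonneg_right (sum_le_sum fun x _ =>
      mul_le_mul_of_nonneg_left (le_abs_self _) (hf0 x)) hN.le
  have h6 : W ^ (2 * r) ≤ α ^ (2 * r - 1) * ((2 * r - 1 : ℝ) ^ (r * k) * W ^ r) :=
    calc W ^ (2 * r) ≤ ((∑ x, f x * |g x|) / 2 ^ m) ^ (2 * r) := pow_le_pow_left₀ hW0 h5 _
      _ ≤ α ^ (2 * r - 1) * ((∑ x, (g x ^ 2) ^ r) / 2 ^ m) := h4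
      _ ≤ α ^ (2 * r - 1) * ((2 * r - 1 : ℝ) ^ (r * k) * W ^ r) :=
          mul_le_mul_of_nonneg_left h3 (pow_nonneg hα0 _)
  rcases hW0.eq_or_lt with hWz | hWpos
  · rw [← hWz, zero_pow hr0.ne']; positivity
  · have hWr : 0 < W ^ r := pow_pos hWpos r
    rw [pow_mul, sq, mul_pow, ← mul_assoc] at h6
    calc W ^ r = W ^ r * W ^ r / W ^ r := by rw [mul_div_cancel_right₀ _ hWr.ne']
      _ ≤ α ^ (2 * r - 1) * (2 * r - 1 : ℝ) ^ (r * k) * W ^ r / W ^ r :=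
          div_le_div_of_nonneg_right h6 hWr.le
      _ = α ^ (2 * r - 1) * (2 * r - 1 : ℝ) ^ (r * k) := by rw [mul_div_cancel_right₀ _ hWr.ne']

/-- **The level-`k` inequality** (O'Donnell 2014, §9.5): for `0 ≤ f ≤ 1` with mean `α > 0`,
`W_k[f] = ∑_{|S|=k} f̂(S)² ≤ e · α² · (2 ln(1/α) + 3)^k` for every `k`
(take `r = ⌈ln(1/α)⌉ + 1` in `levelK_pow_le`, so that `α^{-1/r} ≤ e` and `2r - 1 ≤ 2 ln(1/α) + 3`).
O'Donnell's printed form is `W_{≤k}[f] ≤ α² (2e ln(1/α)/k)^k` for `k ≤ 2 ln(1/α)`; the version here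
holds for all `k` at the price of the constants. [cite: ODonnell2014, §9.5 (Level-k Inequalities)] -/
theorem levelK_le_log (f : (Fin m → Bool) → ℝ) (hf0 : ∀ x, 0 ≤ f x) (hf1 : ∀ x, f x ≤ 1) (k : ℕ)
    (hα : 0 < cubeFourierCoeff f ∅) :
    levelWeight f k ≤
      Real.exp 1 * cubeFourierCoeff f ∅ ^ 2 * (2 * Real.log (1 / cubeFourierCoeff f ∅) + 3) ^ k := by
  set α : ℝ := cubeFourierCoeff f ∅ with hα_def
  have hα1 : α ≤ 1 := by
    rw [hα_def, cubeFourierCoeff_empty, div_le_one (by positivity)]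
    calc ∑ x, f x ≤ ∑ _x : Fin m → Bool, (1 : ℝ) := sum_le_sum fun x _ => hf1 x
      _ = 2 ^ m := by simp
  have hlog0 : 0 ≤ Real.log (1 / α) := Real.log_nonneg (by rw [le_div_iff₀ hα]; linarith)
  set r : ℕ := ⌈Real.log (1 / α)⌉₊ + 1 with hr_def
  have hr1 : 1 ≤ r := Nat.le_add_left 1 _
  have hrlog : Real.log (1 / α) ≤ r := by
    rw [hr_def]; push_cast
    linarith [Nat.le_ceil (Real.log (1 / α))]
  have hrle : (r : ℝ) ≤ Real.log (1 / α) + 2 := by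
    rw [hr_def]; push_cast
    linarith [Nat.ceil_lt_add_one hlog0]
  have hW0 := levelWeight_nonneg f k
  have hmom := levelK_pow_le f hf0 hf1 k r hr1
  rw [← hα_def] at hmom
  clear_value r
  -- `α^{2r-1} ≤ e^r α^{2r}`
  have hexp : α ^ (2 * r - 1) ≤ Real.exp 1 ^ r * α ^ (2 * r) := by
    have h1 : 1 ≤ Real.exp 1 ^ r * α := by
      have h := Real.exp_le_exp.2 hrlog
      rw [Real.exp_log (by positivity), show ((r : ℕ) : ℝ) = (r : ℝ) * 1 by ring,
        Real.exp_nat_mul] at h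
      rwa [div_le_iff₀ hα] at h
    calc α ^ (2 * r - 1) = α ^ (2 * r - 1) * 1 := (mul_one _).symm
      _ ≤ α ^ (2 * r - 1) * (Real.exp 1 ^ r * α) := mul_le_mul_of_nonneg_left h1 (by positivity)
      _ = Real.exp 1 ^ r * (α ^ (2 * r - 1) * α) := by ring
      _ = Real.exp 1 ^ r * α ^ (2 * r) := by rw [pow_sub_one_mul (by omega)]
  set B : ℝ := Real.exp 1 * α ^ 2 * (2 * r - 1 : ℝ) ^ k with hB_def
  have h2r : (0 : ℝ) ≤ 2 * r - 1 := by
    have : (1 : ℝ) ≤ r := by exact_mod_cast hr1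
    linarith
  have hB0 : 0 ≤ B := by positivity
  have hpow : levelWeight f k ^ r ≤ B ^ r := by
    calc levelWeight f k ^ r ≤ α ^ (2 * r - 1) * (2 * r - 1 : ℝ) ^ (r * k) := hmom
      _ ≤ (Real.exp 1 ^ r * α ^ (2 * r)) * (2 * r - 1 : ℝ) ^ (r * k) :=
          mul_le_mul_of_nonneg_right hexp (by positivity)
      _ = B ^ r := by rw [hB_def, mul_pow, mul_pow, ← pow_mul, ← pow_mul, mul_comm r k]
  have hle : levelWeight f k ≤ B := (pow_le_pow_iff_left₀ hW0 hB0 (by omega)).1 hpow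
  calc levelWeight f k ≤ B := hle
    _ ≤ Real.exp 1 * α ^ 2 * (2 * Real.log (1 / α) + 3) ^ k := by
        rw [hB_def]
        refine mul_le_mul_of_nonneg_left (pow_le_pow_left₀ h2r (by linarith) k) (by positivity)

end Literature.Computability.Complexity.LowDegree

end
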